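import Literature.Computability.Complexity.ExpTimeMaps
import Literature.Computability.Complexity.CodeFPArith
import Literature.Computability.Complexity.CodeFPStrings
import Literature.Computability.Complexity.SplitOnesBricks
import Literature.Computability.Complexity.LengthCompare
import Literature.Computability.Complexity.IntPairBricks
import HarnessLib

/-!
# Exponentially long tables in `FE` and languages of pairs in `E`, written as typed programs on the pad

Literature / complexity toolkit, companion of `ExpTimeMaps.lean` (`FE = ⋃_c FTIME(2^{cn})`, the
linear-exponential pad `lpad a x = ⟨1^{2^{a|x|}} 0 1^{a|x|}, x⟩ ∈ FE`, `comp_mem_FE`, `preimage_mem_E`)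
and of the typed layer `CodeFP` (`CodeFP.lean`, `CodeFPArith.lean`). An exponential-time construction
— the proof oracle of a probabilistically checkable proof for a language in `E` (Babai–Fortnow–Lund;
Buhrman–Fortnow–Pavan, Thm. 3.3: "a probabilistically checkable proof of this computation
computable in time `2^{O(n)}`"), a truth table, a table of sumcheck messages — is a POLYNOMIAL-time
program in the length of the pad, and the pad hands the program its budget `1^{2^{a|x|}}` in unary.
This file packages that once, so that such constructions are written as `CodeFP` programs and never
as machines:

* `CodeFP.lpadE a = lpad a` as an input code of `x`, with the three typed readers `lpadArg`
  (`x` itself), `lpadBudget` (`2^{a|x|}` in unary), `lpadExp` (`a|x|` in unary);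
* **`exists_table_mem_FE`** — from a table length `T` and a bit function `g x i`, both computed on the
  pad in polynomial time (`CodeFP (lpadE a) unE T`, `CodeFP (pairE (lpadE a) natE) bitE g`), a map
  `P ∈ FE` with `P x = [g x 0, …, g x (T x - 1)]` (so `(P x)[i] = g x i` for `i < T x` and `false`
  beyond: `getD_table`; the bits are flattened by `CodeFP.bitsToStr` of `CodeFPStrings.lean`);
* **`exists_pairLang_mem_E`** — from a predicate `pr x y` computed on `(pad of x, y)` in polynomial
  time, a language `L ∈ E` with `⟨x, y⟩ ∈ L ↔ pr x y`.

Everything is proved; nothing here is specific to PCPs (the one-bit test `Brick.isTrue1Fn` of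
`IntPairBricks.lean` decides the preimage language).

## References

* S. Arora, B. Barak, *Computational Complexity: A Modern Approach*, CUP 2009, §2.6.2 (`E`, `EXP`,
  padding), §1.3 (Claim 1.6: composition of running times) [AroraBarakCC2009].
* H. Buhrman, L. Fortnow, A. Pavan, *Some results on derandomization*, Theory Comput. Syst. 38 (2005),
  Thm. 3.3 (the proof is computable in time `t^{1+ε}`) [BuhrmanFortnowPavan2004].
-/

namespace Literature.Computability.Complexity

open _root_.Computability Polynomial Brick

namespace CodeFP

variable {α : Type} {eα : α → List Bool}

/-! ### The pad as an input code -/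

/-- The linear-exponential pad `x ↦ ⟨1^{2^{a|x|}} 0 1^{a|x|}, x⟩` as an input code of `x`. [cite: AroraBarakCC2009, §2.6.2] -/
abbrev lpadE (a : ℕ) : List Bool → List Bool := lpad a

/-- The pad, spelled out. [folklore] -/
theorem lpadE_apply (a : ℕ) (x : List Bool) :
    lpadE a x = boolPair (ones (2 ^ (a * x.length)) ++ false :: ones (a * x.length)) x := by
  simp [lpadE, lpad, expPad, ones]

/-- **The payload** `x`, read off the pad. [folklore] -/
theorem lpadArg (a : ℕ) : CodeFP (lpadE a) strE (fun x => x) :=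
  ⟨sndF, sndF_mem_FP, fun x => by rw [lpadE_apply, sndF_boolPair]; rfl⟩

/-- **The budget** `2^{a|x|}` in unary, read off the pad. [folklore] -/
theorem lpadBudget (a : ℕ) : CodeFP (lpadE a) unE (fun x => 2 ^ (a * x.length)) :=
  ⟨onesPrefixFn ∘ fstF, comp_mem_FP onesPrefixFn_mem_FP fstF_mem_FP, fun x => by
    rw [Function.comp_apply, lpadE_apply, fstF_boolPair, onesPrefixFn_ones_append, unE_eq_ones]⟩

/-- **The exponent** `a|x|` in unary, read off the pad. [folklore] -/
theorem lpadExp (a : ℕ) : CodeFP (lpadE a) unE (fun x => a * x.length) :=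
  ⟨afterZeroFn ∘ fstF, comp_mem_FP afterZeroFn_mem_FP fstF_mem_FP, fun x => by
    rw [Function.comp_apply, lpadE_apply, fstF_boolPair, afterZeroFn_ones_append, unE_eq_ones]⟩

/-! ### Tables in `FE` -/

/-- **Exponentially long tables are in `FE`**: a table length `T x` and a bit function `g x i`, both
computed in polynomial time ON THE PAD of `x`, give a string map `P ∈ FE` tabulating `g x` below `T x`.
[cite: AroraBarakCC2009, §2.6.2 with §1.3] [cite: BuhrmanFortnowPavan2004, Thm. 3.3 ("computable in time t^{1+ε}")] -/
theorem exists_table_mem_FE {a : ℕ} {T : List Bool → ℕ} {g : List Bool → ℕ → Bool}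
    (hT : CodeFP (lpadE a) unE T) (hg : CodeFP (pairE (lpadE a) natE) bitE (fun q => g q.1 q.2)) :
    ∃ P ∈ FE, ∀ x, P x = (List.range (T x)).map (g x) := by
  obtain ⟨f, hf, hfx⟩ := bitsToStr.comp ((map hg).comp ((CodeFP.id (lpadE a)).pair (urange.comp hT)))
  exact ⟨f ∘ lpad a, comp_mem_FE hf (lpad_mem_FE a), fun x => hfx x⟩

/-- Reading a tabulated bit: position `i < T x` holds `g x i`, positions past the end read `false`. [folklore] -/
theorem getD_table {T : List Bool → ℕ} {g : List Bool → ℕ → Bool} {P : List Bool → List Bool}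
    (hP : ∀ x, P x = (List.range (T x)).map (g x)) (x : List Bool) (i : ℕ) :
    (P x).getD i false = (decide (i < T x) && g x i) := by
  rw [hP]
  by_cases hi : i < T x
  · rw [List.getD_eq_getElem _ _ (by simpa using hi)]
    simp [hi]
  · rw [List.getD_eq_default _ _ (by simpa using hi)]
    simp [hi]

/-! ### Languages of pairs in `E` -/

/-- **Languages of pairs decided in polynomial time on the pad are in `E`**: a predicate `pr x y`
computed in polynomial time on `(pad of x, y)` gives `L ∈ E` with `⟨x, y⟩ ∈ L ↔ pr x y`.
[cite: AroraBarakCC2009, §2.6.2 with §1.3] -/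
theorem exists_pairLang_mem_E {a : ℕ} {pr : List Bool → List Bool → Bool}
    (hpr : CodeFP (pairE (lpadE a) strE) bitE (fun q => pr q.1 q.2)) :
    ∃ L ∈ E, ∀ x y : List Bool, boolPair x y ∈ L ↔ pr x y = true := by
  obtain ⟨f, hf, hfx⟩ := hpr
  let A : Language Bool := {w | isTrue1Fn (f w) = [true]}
  have hA : A ∈ Classes.P :=
    mem_P_of_mem_FP (comp_mem_FP isTrue1Fn_mem_FP hf) A fun w =>
      ⟨fun h => h, fun h => by
        change ¬ (isTrue1Fn (f w) = [true]) at h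
        change isTrue1Fn (f w) = [false]
        rw [isTrue1Fn_apply] at h ⊢
        simpa using h⟩
  refine ⟨mapFstFn (lpad a) ⁻¹' A, preimage_mem_E (mapFstFn_mem_FE (lpad_mem_FE a)) hA, fun x y => ?_⟩
  change isTrue1Fn (f (mapFstFn (lpad a) (boolPair x y))) = [true] ↔ _
  rw [mapFstFn_boolPair, show f (boolPair (lpad a x) y) = [pr x y] from hfx (x, y), isTrue1Fn_apply]
  cases pr x y <;> simp

end CodeFP

end Literature.Computability.Complexity
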